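import Summits.AtomisticToContinuum.HydrodynamicLimit.Theses.TwoClocks
import Summits.AtomisticToContinuum.HydrodynamicLimit.Theorems.EquilibriumClampedCollisionalWindowLD.Negative.MainBound
import Summits.AtomisticToContinuum.HydrodynamicLimit.Theorems.EquilibriumClampedCollisionalWindowLD.Negative.FinalIneq2

/-!
# Negative lemma for crux `TwoClocks.ClampedTransferWindowLD` (stmt-AtomisticToContinuum-16623): the ENERGY part of the
transfer-activity clamp is load-bearing

The refuted statement (inlined after `¬`; named `ClampedTransferWindowLDWithoutEnergyImpulse` in the crux workfile) is the crux with the energy impulse `|‖v_i⁺‖² − ‖v_i⁻‖²|/2` deleted from the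
clamp activity (momentum impulse `‖Δv_i‖` only) — verbatim the predecessor crux stmt-AtomisticToContinuum-13733, which was
restated away from the Theses files after its refutation (p123367). `clampedTransferWindowLD_false_without_energyImpulse`
re-derives `¬` of it from the landed helper modules `Theorems/EquilibriumClampedCollisionalWindowLD/Negative/*` (frozen
line-lattice Newton-cradle relay against the energy row), so that the negative knowledge stays kernel-checked and importable
now that the old Theses decl is gone. Moral for provers of C′: any argument insensitive to the `|Δ‖v‖²|/2` term of the
activity proves a false statement. No Theses declaration is asserted positively (Negative/ lane, `--supports`).
refuter-cdisprove-stmt-AtomisticToContinuum-16623-0, 2026-08-16; crux workfile `Cruxes/ClampedTransferWindowLD/Disproof.lean`.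
-/

noncomputable section

open Real
open scoped InnerProductSpace

namespace Summit.AtomisticToContinuum.HydrodynamicLimit.Theorems.ClampedTransferWindowLDNegative

open Summit.AtomisticToContinuum.HydrodynamicLimit.Theorems
open Summit.AtomisticToContinuum.HydrodynamicLimit.Theorems.EquilibriumClampedCollisionalWindowLDNegative
open MeasureTheory Literature.Analysis.FluidPDE Literature.Analysis.FunctionSpaces Literature.MathematicalPhysics.KineticTheory

/-- **Any proof of C′ must use the energy part of the activity clamp.** With the activity reduced to the momentum impulse,
the ENERGY row is false: frozen line-lattice Newton-cradle relay (equilibrium data `a₀ = θ₀ = 1, u₀ = 0`, `σ = (4/5)/l²`,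
`φ = cos 2π x₀`, `V ≥ 1`, `β = β₀`, `ε = 1`, `τ = t⁴`, `N + 1 = (l n)³`): a relay sphere has momentum activity
`(σ/τ)·2V_p ≍ 1/(l² t) ≤ V` while each transfer moves the energy `V_p²/2 = t⁶/2` one slot up `∇(−φ)`, so
`w⁻¹Xᵉ ≍ (N+1) t²/l²` against a Gibbs cost `≤ (N+1)(216 log t + C(l))`. Proof text = the accepted refutation of
stmt-13733 (p123367), run on the landed helper modules. [folklore] -/
theorem clampedTransferWindowLD_false_without_energyImpulse :
    ¬ (∃ σ₀ : ℝ, 0 < σ₀ ∧ ∀ (a₀ θ₀ : ℝ) (u₀ : Literature.MathematicalPhysics.KineticTheory.V3), 0 < a₀ → 0 < θ₀ → ∀ σ : ℝ, 0 < σ → σ < σ₀ → ∀ Φ : (N : ℕ) → Literature.Analysis.FluidPDE.HardSphereFlow (Literature.Analysis.FluidPDE.Torus.geometry (Fin 3)) (Literature.MathematicalPhysics.KineticTheory.hsDiameter σ N) (N + 1), ∀ φ : Literature.MathematicalPhysics.KineticTheory.T3 → ℝ, Literature.Analysis.FunctionSpaces.Torus.IsSmooth φ → ∃ V₀ : ℝ,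 0 < V₀ ∧ ∀ V : ℝ, V₀ ≤ V → ∃ β₀ : ℝ, 0 < β₀ ∧ ∀ β : ℝ, |β| ≤ β₀ → ∀ ε : ℝ, 0 < ε → ∃ τ₀ : ℝ, 0 < τ₀ ∧ ∀ τ : ℝ, τ₀ ≤ τ → ∃ N₀ : ℕ, ∀ N : ℕ, N₀ ≤ N → (let w : ℝ := τ * ((N : ℝ) + 1) ^ (-(1 / 3 : ℝ)); let P := Literature.MathematicalPhysics.KineticTheory.localGibbsLaw σ (fun _ => a₀) (fun _ => u₀) (fun _ => θ₀) N (Φ N); let Z : ℝ := Literature.MathematicalPhysics.KineticTheory.hsCompressibility (σ ^ 3); let Z' : ℝ := deriv Literature.MathematicalPhysics.KineticTheory.hsCompressibility (σ ^ 3); let act := fun (i : Fin (N + 1)) (z : Literature.Analysis.FluidPDE.Config (N + 1) (Fin 3) Literature.MathematicalPhysics.KineticTheory.T3) => σ / τ * (Φ N).collisionSum (Set.Ioc 0 w) (fun c => if c.fst = i then ‖c.postVel.1 - c.preVel.1‖ else 0) z; let ω := fun (i : Fin (N + 1)) (z : Literature.Analysis.FluidPDE.Config (N + 1) (Fin 3)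 Literature.MathematicalPhysics.KineticTheory.T3) => if act i z ≤ V then (1 : ℝ) else 0; let Xm := fun (k : Fin 3) (z : Literature.Analysis.FluidPDE.Config (N + 1) (Fin 3) Literature.MathematicalPhysics.KineticTheory.T3) => (Φ N).collisionSum (Set.Ioc 0 w) (fun c => ω c.fst z * ω c.snd z * ((φ c.fstPos - φ c.sndPos) * (c.postVel.1 k - c.preVel.1 k)) / 2) z; let Am := fun (k : Fin 3) (z : Literature.Analysis.FluidPDE.Config (N + 1) (Fin 3) Literature.MathematicalPhysics.KineticTheory.T3) => ∫ r in (0 : ℝ)..w, ∑ i, Literature.Analysis.FunctionSpaces.Torus.partialDeriv k φ ((Φ N).flow r z i).1 * (θ₀ * σ ^ 3 * Z' + (1 / 3) * (Z - 1) * ‖((Φ N).flow r z i).2 - u₀‖ ^ 2); let Xe := fun (z : Literature.Analysis.FluidPDE.Config (N + 1) (Fin 3) Literature.MathematicalPhysics.KineticTheory.T3) => (Φ N).collisionSum (Set.Ioc 0 w) (fun c => ω c.fst z * ω c.snd z * ((φ c.fstPos - φ c.sndPos) * ((‖c.postVel.1‖ ^ 2 - ‖c.preVel.1‖ ^ 2)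 / 2)) / 2) z; let Ae := fun (z : Literature.Analysis.FluidPDE.Config (N + 1) (Fin 3) Literature.MathematicalPhysics.KineticTheory.T3) => ∫ r in (0 : ℝ)..w, ∑ i, ((∑ l, u₀ l * Literature.Analysis.FunctionSpaces.Torus.partialDeriv l φ ((Φ N).flow r z i).1) * (θ₀ * σ ^ 3 * Z' + (1 / 3) * (Z - 1) * ‖((Φ N).flow r z i).2 - u₀‖ ^ 2) + θ₀ * (Z - 1) * (∑ l, Literature.Analysis.FunctionSpaces.Torus.partialDeriv l φ ((Φ N).flow r z i).1 * (((Φ N).flow r z i).2 - u₀) l)); (∀ k : Fin 3, ∫⁻ z, ENNReal.ofReal (Real.exp (β * (w⁻¹ * Xm k z - w⁻¹ * Am k z))) ∂P ≤ ENNReal.ofReal (Real.exp (ε * ((N : ℝ) + 1)))) ∧ ∫⁻ z, ENNReal.ofReal (Real.exp (β * (w⁻¹ * Xe z - w⁻¹ * Ae z))) ∂P ≤ ENNReal.ofReal (Real.exp (ε * ((N : ℝ) + 1))))) := by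
  classical
  rintro ⟨σ₀, hσ₀, H⟩
  -- the packing fraction `σ = (4/5)/l²`
  obtain ⟨l, hl, hlσ⟩ : ∃ l : ℕ, 2 ≤ l ∧ (4 / 5 : ℝ) / (l : ℝ) ^ 2 < σ₀ := by
    refine ⟨⌈1 / σ₀⌉₊ + 2, by omega, ?_⟩
    have h1 : 1 / σ₀ ≤ ⌈1 / σ₀⌉₊ := Nat.le_ceil _
    have hl2 : (1 / σ₀ : ℝ) + 2 ≤ ((⌈1 / σ₀⌉₊ + 2 : ℕ) : ℝ) := by push_cast; linarith
    have hpos : 0 < 1 / σ₀ := by positivity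
    set L : ℝ := ((⌈1 / σ₀⌉₊ + 2 : ℕ) : ℝ)
    have hL : 1 / σ₀ < L := by linarith
    have hL1 : 1 ≤ L := by linarith
    rw [div_lt_iff₀ (by positivity)]
    have : 1 < σ₀ * L := by rwa [div_lt_iff₀' hσ₀] at hL
    nlinarith
  set σ : ℝ := (4 / 5) / (l : ℝ) ^ 2 with hσdef
  have hl0 : (0 : ℝ) < l := by exact_mod_cast (show 0 < l by omega)
  have hl2 : (2 : ℝ) ≤ l := by exact_mod_cast hl
  have hσ : 0 < σ := by positivity
  have hσ5 : σ ≤ 1 / 5 := by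
    rw [hσdef, div_le_iff₀ (by positivity)]; nlinarith
  have hσ2 : σ < 1 / 2 := by linarith
  specialize H 1 1 (0 : V3) one_pos one_pos σ hσ hlσ (flowFam hσ hσ2) phi isSmooth_phi
  obtain ⟨V₀, hV₀, H⟩ := H
  specialize H (max V₀ 1) (le_max_left _ _)
  obtain ⟨β₀, hβ₀, H⟩ := H
  specialize H β₀ (by rw [abs_of_pos hβ₀]) 1 one_pos
  obtain ⟨τ₀, hτ₀, H⟩ := H
  -- `Z` and the choice of `t` (`τ = t⁴`)
  set Z : ℝ := hsCompressibility (σ ^ 3) with hZ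
  set Z' : ℝ := deriv hsCompressibility (σ ^ 3) with hZ'
  obtain ⟨t, ht, hτt, hbig⟩ : ∃ t : ℕ, 24 * l ^ 2 ≤ t ∧ τ₀ ≤ (t : ℝ) ^ 4 ∧
      39 * (l : ℝ) ^ 2 * (224 + 6 * l + 40 * β₀ * |Z - 1|) ≤ β₀ * t := by
    set X : ℝ := 39 * (l : ℝ) ^ 2 * (224 + 6 * l + 40 * β₀ * |Z - 1|) / β₀ with hX
    refine ⟨⌈τ₀⌉₊ + 24 * l ^ 2 + ⌈X⌉₊ + 1, by omega, ?_, ?_⟩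
    · have h1 : τ₀ ≤ ⌈τ₀⌉₊ := Nat.le_ceil _
      have h2 : (⌈τ₀⌉₊ : ℝ) ≤ ((⌈τ₀⌉₊ + 24 * l ^ 2 + ⌈X⌉₊ + 1 : ℕ) : ℝ) := by exact_mod_cast (by omega)
      have h3 : (1 : ℝ) ≤ ((⌈τ₀⌉₊ + 24 * l ^ 2 + ⌈X⌉₊ + 1 : ℕ) : ℝ) := by exact_mod_cast (by omega)
      calc τ₀ ≤ ((⌈τ₀⌉₊ + 24 * l ^ 2 + ⌈X⌉₊ + 1 : ℕ) : ℝ) := h1.trans h2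
        _ = ((⌈τ₀⌉₊ + 24 * l ^ 2 + ⌈X⌉₊ + 1 : ℕ) : ℝ) ^ 1 := (pow_one _).symm
        _ ≤ _ := pow_le_pow_right₀ h3 (by norm_num)
    · have h1 : X ≤ ⌈X⌉₊ := Nat.le_ceil _
      have h2 : (⌈X⌉₊ : ℝ) ≤ ((⌈τ₀⌉₊ + 24 * l ^ 2 + ⌈X⌉₊ + 1 : ℕ) : ℝ) := by exact_mod_cast (by omega)
      have h3 : X ≤ ((⌈τ₀⌉₊ + 24 * l ^ 2 + ⌈X⌉₊ + 1 : ℕ) : ℝ) := h1.trans h2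
      have := mul_le_mul_of_nonneg_left h3 hβ₀.le
      rw [hX, mul_div_cancel₀ _ hβ₀.ne'] at this
      exact this
  specialize H ((t : ℝ) ^ 4) hτt
  obtain ⟨N₀, H⟩ := H
  -- the choice of `n` and `N + 1 = (l n)³`
  set n : ℕ := N₀ + 18 * t ^ 7 * l ^ 2 + 10 with hn
  have hn2 : 2 ≤ n := by omega
  have hn1 : 1 ≤ n := by omega
  set N : ℕ := (l * n) ^ 3 - 1 with hNdef
  have hln : 1 ≤ l * n := Nat.mul_pos (by omega) (by omega)
  have hN : N + 1 = (l * n) ^ 3 := by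
    have : 1 ≤ (l * n) ^ 3 := Nat.one_le_pow _ _ hln; omega
  have hN₀ : N₀ ≤ N := by
    have h1 : l * n ≤ (l * n) ^ 3 := by
      calc l * n = (l * n) ^ 1 := (pow_one _).symm
        _ ≤ (l * n) ^ 3 := Nat.pow_le_pow_right hln (by norm_num)
    have h2 : n ≤ l * n := Nat.le_mul_of_pos_left n (by omega)
    omega
  specialize H N hN₀
  obtain ⟨-, hE⟩ := H
  -- the lattice
  set Λ := LatW' l n t with hΛ
  have hΛeq : Λ = LatW l n t := LatW'_eq hl hn1
  have hcard : Fintype.card Λ.Slot = N + 1 := by rw [hΛeq, LatW.card_slot, hN]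
  have hchart : 4 * (6 * (t : ℝ) ^ 7 * (l : ℝ) ^ 2 + 4) ≤ (l : ℝ) ^ 3 * n := by
    have hn' : ((18 * t ^ 7 * l ^ 2 + 10 : ℕ) : ℝ) ≤ n := by exact_mod_cast (by omega)
    push_cast at hn'
    have hl8 : (8 : ℝ) ≤ (l : ℝ) ^ 3 := by
      have := pow_le_pow_left₀ (by norm_num : (0:ℝ) ≤ 2) hl2 3; norm_num at this; exact this
    have h0 : (0 : ℝ) ≤ (t : ℝ) ^ 7 * (l : ℝ) ^ 2 := by positivity
    have h1 : (8 : ℝ) * n ≤ (l : ℝ) ^ 3 * n := mul_le_mul_of_nonneg_right hl8 (by positivity)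
    nlinarith
  have hW : Λ.WinOK := by rw [hΛeq]; exact LatW.winOK hl ht hn1 hchart
  have hG : Λ.GainOK := by rw [hΛeq]; exact LatW.gainOK hl ht hn1
  obtain ⟨hε12, hr12, -⟩ : Λ.P.ε < 1 / 2 ∧ Λ.P.r < 1 / 2 ∧ (4 / 5 : ℝ) / (l : ℝ) ^ 2 ≤ 1 / 2 := by
    rw [hΛeq]; exact LatW.small_facts hl ht hn1
  have hn0 : (0:ℝ) < n := by exact_mod_cast (show 0 < n by omega)
  have hT := bpar.Tpos hl ht
  have hc := LatW.c_pos (l := l) (n := n) hl hn1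
  have hw0 : 0 < Λ.w := by show 0 < cscale l n * ((t : ℝ) ^ 4 * (l : ℝ) ^ 2); positivity
  have hεσ : hsDiameter σ N = Λ.P.ε := rfl
  have hgoodP : localGibbsMeasure σ (fun _ => 1) (fun _ => 0) (fun _ => (1 : ℝ)) N (flowFam hσ hσ2 N).goodᶜ = 0 :=
    localGibbsMeasure_absolutelyContinuous σ _ _ _ N (flowFam hσ hσ2 N) (flowFam hσ hσ2 N).measure_compl_good
  have hκ : 0 ≤ σ / (t : ℝ) ^ 4 := by positivity
  have hVcl : σ / (t : ℝ) ^ 4 * (2 * Λ.P.Vhi) ≤ max V₀ 1 := by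
    refine le_trans ?_ (le_max_right _ _)
    rw [hΛeq, LatW.P_eq, Params.scale_Vhi _ hc.ne']
    obtain ⟨-, -, -, hVhi⟩ := bpar.V_bd hl ht
    have ht3 := bpar.T3 hl ht
    have h1 := bpar.T1 hl ht
    rw [div_mul_eq_mul_div, div_le_one (by positivity)]
    have : (t : ℝ) ^ 4 = t * (t : ℝ) ^ 3 := by ring
    nlinarith
  obtain ⟨-, -, -, w4, w5, -⟩ := bpar.win_facts hl ht
  have hkK : 4 * t ^ 7 * l ^ 2 + 1 ≤ Λ.P.K := by rw [hΛeq]; exact w5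
  have hkw : ((4 * t ^ 7 * l ^ 2 : ℕ) : ℝ) * Λ.P.θhi ≤ Λ.w := by
    rw [hΛeq, LatW.P_eq, Params.scale_θhi _ hc.ne', LatW.w_eq]
    calc ((4 * t ^ 7 * l ^ 2 : ℕ) : ℝ) * (cscale l n * (bpar l t).θhi)
        = cscale l n * (((4 * t ^ 7 * l ^ 2 : ℕ) : ℝ) * (bpar l t).θhi) := by ring
      _ ≤ cscale l n * ((t : ℝ) ^ 4 * (l : ℝ) ^ 2) := mul_le_mul_of_nonneg_left w4 hc.le
  have hM : 24 * Λ.m ≤ Λ.M := by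
    show 24 * (6 * t ^ 7 * l ^ 2 + 3) ≤ l ^ 3 * n
    have hl8 : 8 ≤ l ^ 3 := by
      calc 8 = 2 ^ 3 := by norm_num
        _ ≤ l ^ 3 := Nat.pow_le_pow_left hl 3
    have hn' : 18 * t ^ 7 * l ^ 2 + 10 ≤ n := by omega
    calc 24 * (6 * t ^ 7 * l ^ 2 + 3) = 8 * (18 * t ^ 7 * l ^ 2 + 9) := by ring
      _ ≤ l ^ 3 * n := Nat.mul_le_mul hl8 (by omega)
  -- the main bound and the final inequality
  have key := Lat.lintegral_ge (Λ := Λ) (Φ := flowFam hσ hσ2 N) hcard hW hG hε12 hr12 hw0 (by linarith) hεσ hgoodP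
    (V := max V₀ 1) (Z := Z) (Z' := Z') hκ hVcl hβ₀.le hkK hkw hM
  have hfin := LatW.final_ineq hl ht hn2 hN hβ₀ Z hbig
  rw [← hΛeq] at hfin
  have hlt : ENNReal.ofReal (Real.exp (1 * ((N : ℝ) + 1))) <
      ENNReal.ofReal (((N + 1).factorial : ℝ) * Real.exp (Λ.Fmin N (4 * t ^ 7 * l ^ 2) β₀ Z) * Λ.evB N) := by
    rw [one_mul, ENNReal.ofReal_lt_ofReal_iff (lt_trans (Real.exp_pos _) hfin)]
    exact hfin
  -- identify the statement's integral with ours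
  have hw : (t : ℝ) ^ 4 * ((N : ℝ) + 1) ^ (-(1 / 3 : ℝ)) = Λ.w := by
    rw [LatW.w_eq_stmt (t := t) hl hn1 hN, hΛeq]
  simp only [] at hE
  rw [localGibbsLaw_eq, hw] at hE
  exact absurd (lt_of_lt_of_le hlt (key.trans hE)) (lt_irrefl _)

end Summit.AtomisticToContinuum.HydrodynamicLimit.Theorems.ClampedTransferWindowLDNegative

end
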